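/-
Copyright (c) 2026 the pub-hodgecm-mathlib formalisation cell (harness21).  Prover seat hodgecm-mathlib-LH3-p01 (g7); dealer LH4-plan (g7) WORD #26 ∕ #59 «(C6)-5 CLOSED»,
2026-09-02.  Count-neutral reader layer of the dyadic (D-UNR) column; CENSUS-C6 196c9bc3 file 5, closed form.
-/
import Literature.NumberTheory.Rogawski1990.DepthZeroKappaTransferTypeOneUnitRowStrataTrace          -- ★ p851990: the two `_of_count` heads (unit-row strata sums at the trace literals, export count as hypothesis)
import Literature.NumberTheory.Rogawski1990.UnitOrbitalIntegralInertValueThetaZeroAdicCompletionTrace   -- ★ (C5)′ EXPORT θ̄ = 0 (F0P3a-p02): `natCard_fixedPoints_unitaryInt_traceTorus_eq_phiZero_adicCompletion`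
import Literature.NumberTheory.Rogawski1990.UnitOrbitalIntegralInertValueThetaOneAdicCompletionTrace    -- ★ (C5)′ EXPORT θ̄ = 1 (F0P3a-p02): `natCard_fixedPoints_unitaryInt_traceTorusPi_eq_phiOne_adicCompletion`
import HarnessLib

/-!
# The depth-zero κ-transfer, type (1): the UNIT ROW at the trace literals, CLOSED — `n₀ + n₁ + n₂ = φ₁(Q₁, P)` ∕ `= φ₀(Q₁, Q₂, P)` with the (C5)′ export counts plugged in

Topic `NumberTheory/Rogawski1990`; namespace `Literature.NumberTheory.Rogawski1990`.  THEOREMS ONLY (no definition, no instance, no notation, no named fact, no `sorry`);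
count-neutral; kernel lane `--supports stmt-HodgeConjecture-24833`.  Cell `pub/hodgecm-mathlib`, crux H413 = `stmt-HodgeConjecture-24833`; (C6)-5 of CENSUS-C6 196c9bc3
(LH3-p02 (g6)), dealer LH4-plan (g7) WORD #26 (sequel `…Closed`) ∕ WORD #59.  The two (C5)′ EXPORT heads ★
`UnitaryGroup.natCard_fixedPoints_unitaryInt_traceTorus_eq_phiZero_adicCompletion` ∕ `…traceTorusPi_eq_phiOne_adicCompletion` (F0P3a-p02 (g23); (R-ord) binder order incl.
`(hbδ)`) are IMPORTED and plugged in.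
The CLOSED heads are ★ p851990's `sum_ncard_rankStrata_eq_phiOne_of_congr_traceTorusEltPi_of_count` ∕ `…phiZero_of_congr_traceTorusElt_of_count` with the trailing
hypothesis `hX₁` ∕ `hX₀` discharged by the export at `(L, w, hw, hv)` (one `exact` each; `𝒪_w` `𝔪`-adically complete by ★ `isAdicComplete_maximalIdeal_valuedInteger_adicCompletion`);
binders = the `_of_count` ones with `(hv : IsUnramifiedIn)` re-inserted after `(hw)` (★ `UnitRow` :213 order); conclusions `Flicker1998.phiOne q Q₁ P` ∕ `phiZero q Q₁ Q₂ P` VERBATIM.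
HONEST READER LABEL: HC_CM is proved only modulo the 7 printed citations (2 remaining named inputs: hLiu418 = stmt-HodgeConjecture-24832, h413 = stmt-HodgeConjecture-24833) until
rung 0 closes; count-neutral ((D-UNR) stays PRINT by D74′), pays no organ, opens no road; under FINDING #19 the export counts hold by D1 (row totals), which is all this file uses.

## References
* [Rogawski1990] J. D. Rogawski, *Automorphic Representations of Unitary Groups in Three Variables* (1990), §4.9 Prop. 4.9.1 (b) p. 55.
* [Flicker1998UnitaryFL] Y. Z. Flicker, *Elementary proof of the fundamental lemma for a unitary group*, Canad. J. Math. 50 (1998), Prop. 11 p. 87, Prop. 14 p. 94.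
* [Kottwitz1986] R. E. Kottwitz, *Base change for unit elements of Hecke algebras*, Compositio Math. 60 (1986), §3.
-/

set_option autoImplicit false

noncomputable section

open MeasureTheory Measure Set Function NumberField IsDedekindDomain Matrix Polynomial
open Literature.NumberTheory.Automorphic Literature.NumberTheory.Automorphic.UnitaryGroup
open Literature.NumberTheory.Automorphic.IntegralReduction Literature.NumberTheory.GaloisRepresentations
open Literature.NumberTheory.Automorphic.HermitianLattice (unitaryInt)
open scoped Matrix MatrixGroups ValuativeRel

namespace Literature.NumberTheory.Rogawski1990

variable (L : Type) [Field L] [NumberField L] [IsCMField L] (H' : Matrix (Fin 3) (Fin 3) L)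
  {v : HeightOneSpectrum (𝓞 ↥(maximalRealSubfield L))}

/-! ## §1 The unit row at a θ̄ = 1 trace literal, CLOSED -/

set_option synthInstance.maxHeartbeats 200000 in  -- the coset action `U_w ↷ U_w ⧸ unitaryInt` (as ★)
open scoped Classical in
/-- **THE UNIT ROW AT A θ̄ = 1 TRACE LITERAL, CLOSED**: `n₀(t) + n₁(t) + n₂(t) = φ₁(Q₁, P)` for `t ∈ G′_v` congruent to `t_π^{(b)}(x₁,x₂,x₃)` — ★ p851990
`…_of_count` with its export hypothesis discharged by the (C5)′ θ̄ = 1 EXPORT `natCard_fixedPoints_unitaryInt_traceTorusPi_eq_phiOne_adicCompletion`; twin of ★ `UnitRow` :211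
`sum_ncard_rankStrata_eq_phiOne_of_congr` with `h2 h2e hy` DELETED, `{b} (hb) (hbv) (hbδ)` ADDED. [cite: Flicker1998UnitaryFL, Prop. 11 p. 87; §6 p. 95]
[cite: Rogawski1990, §4.9 Prop. 4.9.1 (b) p. 55] [cite: Kottwitz1986, §3] -/
theorem sum_ncard_rankStrata_eq_phiOne_of_congr_traceTorusEltPi
    (hH' : (H'.map (IsCMField.complexConj L))ᵀ = H') (hH'u : IsUnit H') (w : PlacesOver L v)
    (hw : IsCMField.complexConj L • w.1 = w.1) (hv : Algebra.IsUnramifiedIn (𝓞 L) v.asIdeal)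
    {b π π' x₁ x₂ x₃ : LocalRing L v} (hb : b + conjLocal L (IsCMField.complexConj L) v b = 1) (hbv : Valued.v (b w) ≤ 1)
    (hbδ : Valued.v ((conjLocal L (IsCMField.complexConj L) v b - b) w) = 1)
    (hσπ : conjLocal L (IsCMField.complexConj L) v π = π) (hππ : π * π' = 1)
    (hπN : ∀ z : LocalRing L v, conjLocal L (IsCMField.complexConj L) v z * z ≠ π)
    (hx₁ : conjLocal L (IsCMField.complexConj L) v x₁ * x₁ = 1) (hx₂ : conjLocal L (IsCMField.complexConj L) v x₂ * x₂ = 1)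
    (hx₃ : conjLocal L (IsCMField.complexConj L) v x₃ * x₃ = 1) (h₁₂ : x₁ ≠ x₂) (h₂₃ : x₂ ≠ x₃) (h₁₃ : x₁ ≠ x₃)
    (Tl : GL (Fin 3) (LocalRing L v))
    (ψ : ↥(UnitaryGroup.«local» L (IsCMField.complexConj L) 3 H' v) ≃ₜ*
        ↥(UnitaryGroup.«local» L (IsCMField.complexConj L) 3 (Matrix.of fun i j : Fin 3 => if i.val + j.val + 1 = 3 then (1 : L) else 0) v))
    (t : (cmDatum L 3 H').Local v)
    (hψ : ∀ g, (ψ g).val = Tl * g.val * Tl⁻¹)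
    (hlev : ∀ g, g ∈ cmLocalIntegralLevel L 3 H' v ↔
        ψ g ∈ cmLocalIntegralLevel L 3 (Matrix.of fun i j : Fin 3 => if i.val + j.val + 1 = 3 then (1 : L) else 0) v)
    (hlit : (ψ t).val.val = !![x₁ * conjLocal L (IsCMField.complexConj L) v b + x₃ * b, 0, π * (x₁ - x₃); 0, x₂, 0;
      π' * (b * conjLocal L (IsCMField.complexConj L) v b * (x₁ - x₃)), 0, x₁ * b + x₃ * conjLocal L (IsCMField.complexConj L) v b])
    {P Q₁ Q₂ : ℕ} (hP : Valued.v (x₁ w - x₃ w) = WithZero.exp (-(P : ℤ))) (hQ₁ : Valued.v (x₁ w - x₂ w) = WithZero.exp (-(Q₁ : ℤ)))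
    (hQ₂ : Valued.v (x₃ w - x₂ w) = WithZero.exp (-(Q₂ : ℤ)))
    (hd₁ : Valued.v (x₁ w - 1) < 1) (hd₂ : Valued.v (x₂ w - 1) < 1) (hd₃ : Valued.v (x₃ w - 1) < 1) :
    ((∑ r ∈ Finset.range 3, {q : (cmDatum L 3 H').Local v ⧸ cmLocalIntegralLevel L 3 H' v |
        q ∈ MulAction.fixedBy ((cmDatum L 3 H').Local v ⧸ cmLocalIntegralLevel L 3 H' v) t ∧
          (redMat ((((q.out⁻¹ * t * q.out : (cmDatum L 3 H').Local v)).val : GL (Fin 3) (LocalRing L v)).val.map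
            (Pi.evalRingHom (fun w' : PlacesOver L v => w'.1.adicCompletion L) w)) - 1).rank = r}.ncard : ℕ) : ℚ) =
      Flicker1998.phiOne (Ideal.absNorm v.asIdeal) Q₁ P := by
  haveI : IsAdicComplete (IsLocalRing.maximalIdeal (Valued.integer (w.1.adicCompletion L))) (Valued.integer (w.1.adicCompletion L)) :=
    isAdicComplete_maximalIdeal_valuedInteger_adicCompletion L w.1
  exact sum_ncard_rankStrata_eq_phiOne_of_congr_traceTorusEltPi_of_count L H' hH' hH'u w hw hb hbv hbδ hσπ hππ hπN hx₁ hx₂ hx₃ h₁₂ h₂₃ h₁₃ Tl ψ t hψ hlev hlit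
    hP hQ₁ hQ₂ hd₁ hd₂ hd₃ (natCard_fixedPoints_unitaryInt_traceTorusPi_eq_phiOne_adicCompletion L w hw hv)

/-! ## §2 The unit row at a θ̄ = 0 trace literal, CLOSED -/

set_option synthInstance.maxHeartbeats 200000 in  -- the coset action `U_w ↷ U_w ⧸ unitaryInt` (as ★)
open scoped Classical in
/-- **THE UNIT ROW AT A θ̄ = 0 TRACE LITERAL, CLOSED**: `n₀(t) + n₁(t) + n₂(t) = φ₀(Q₁, Q₂, P)` for `t` congruent to `t_1^{(b)}(x₁,x₂,x₃)` — ★ p851990 `…_of_count` with its export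
hypothesis discharged by the (C5)′ θ̄ = 0 EXPORT `natCard_fixedPoints_unitaryInt_traceTorus_eq_phiZero_adicCompletion`; twin of ★ `UnitRow` :497.
[cite: Flicker1998UnitaryFL, Prop. 14 p. 94; §6 p. 95] [cite: Rogawski1990, §4.9 Prop. 4.9.1 (b) p. 55] [cite: Kottwitz1986, §3] -/
theorem sum_ncard_rankStrata_eq_phiZero_of_congr_traceTorusElt
    (hH' : (H'.map (IsCMField.complexConj L))ᵀ = H') (hH'u : IsUnit H') (w : PlacesOver L v)
    (hw : IsCMField.complexConj L • w.1 = w.1) (hv : Algebra.IsUnramifiedIn (𝓞 L) v.asIdeal)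
    {b x₁ x₂ x₃ : LocalRing L v} (hb : b + conjLocal L (IsCMField.complexConj L) v b = 1) (hbv : Valued.v (b w) ≤ 1)
    (hbδ : Valued.v ((conjLocal L (IsCMField.complexConj L) v b - b) w) = 1)
    (hx₁ : conjLocal L (IsCMField.complexConj L) v x₁ * x₁ = 1) (hx₂ : conjLocal L (IsCMField.complexConj L) v x₂ * x₂ = 1)
    (hx₃ : conjLocal L (IsCMField.complexConj L) v x₃ * x₃ = 1) (h₁₂ : x₁ ≠ x₂) (h₂₃ : x₂ ≠ x₃) (h₁₃ : x₁ ≠ x₃)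
    (Tl : GL (Fin 3) (LocalRing L v))
    (ψ : ↥(UnitaryGroup.«local» L (IsCMField.complexConj L) 3 H' v) ≃ₜ*
        ↥(UnitaryGroup.«local» L (IsCMField.complexConj L) 3 (Matrix.of fun i j : Fin 3 => if i.val + j.val + 1 = 3 then (1 : L) else 0) v))
    (t : (cmDatum L 3 H').Local v)
    (hψ : ∀ g, (ψ g).val = Tl * g.val * Tl⁻¹)
    (hlev : ∀ g, g ∈ cmLocalIntegralLevel L 3 H' v ↔
        ψ g ∈ cmLocalIntegralLevel L 3 (Matrix.of fun i j : Fin 3 => if i.val + j.val + 1 = 3 then (1 : L) else 0) v)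
    (hlit : (ψ t).val.val = !![x₁ * conjLocal L (IsCMField.complexConj L) v b + x₃ * b, 0, x₁ - x₃; 0, x₂, 0;
      b * conjLocal L (IsCMField.complexConj L) v b * (x₁ - x₃), 0, x₁ * b + x₃ * conjLocal L (IsCMField.complexConj L) v b])
    {P Q₁ Q₂ : ℕ} (hP : Valued.v (x₁ w - x₃ w) = WithZero.exp (-(P : ℤ))) (hQ₁ : Valued.v (x₁ w - x₂ w) = WithZero.exp (-(Q₁ : ℤ)))
    (hQ₂ : Valued.v (x₃ w - x₂ w) = WithZero.exp (-(Q₂ : ℤ)))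
    (htri : (Q₁ = Q₂ ∧ Q₁ ≤ P) ∨ (Q₁ = P ∧ Q₁ ≤ Q₂) ∨ (Q₂ = P ∧ Q₂ ≤ Q₁))
    (hd₁ : Valued.v (x₁ w - 1) < 1) (hd₂ : Valued.v (x₂ w - 1) < 1) (hd₃ : Valued.v (x₃ w - 1) < 1) :
    ((∑ r ∈ Finset.range 3, {q : (cmDatum L 3 H').Local v ⧸ cmLocalIntegralLevel L 3 H' v |
        q ∈ MulAction.fixedBy ((cmDatum L 3 H').Local v ⧸ cmLocalIntegralLevel L 3 H' v) t ∧
          (redMat ((((q.out⁻¹ * t * q.out : (cmDatum L 3 H').Local v)).val : GL (Fin 3) (LocalRing L v)).val.map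
            (Pi.evalRingHom (fun w' : PlacesOver L v => w'.1.adicCompletion L) w)) - 1).rank = r}.ncard : ℕ) : ℚ) =
      Flicker1998.phiZero (Ideal.absNorm v.asIdeal) Q₁ Q₂ P := by
  haveI : IsAdicComplete (IsLocalRing.maximalIdeal (Valued.integer (w.1.adicCompletion L))) (Valued.integer (w.1.adicCompletion L)) :=
    isAdicComplete_maximalIdeal_valuedInteger_adicCompletion L w.1
  exact sum_ncard_rankStrata_eq_phiZero_of_congr_traceTorusElt_of_count L H' hH' hH'u w hw hb hbv hbδ hx₁ hx₂ hx₃ h₁₂ h₂₃ h₁₃ Tl ψ t hψ hlev hlit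
    hP hQ₁ hQ₂ htri hd₁ hd₂ hd₃ (natCard_fixedPoints_unitaryInt_traceTorus_eq_phiZero_adicCompletion L w hw hv)

end Literature.NumberTheory.Rogawski1990

end
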